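import Mathlib
import HarnessLib
import HarnessLib.Audit
import Summits.CriticalPhenomena.Statement
import Literature.Analysis.FunctionSpaces.PoissonPointProcess
import Literature.Analysis.FunctionSpaces.PoissonPointProcessExistence
import HarnessLib.Audit.Status.Attr

/-!
Route: ConformalPoissonDevice

# Route ConformalPoissonDevice — exact inversion symmetry of an S³ Poisson–Delaunay Ising device +
one Weyl-universality statement ⇒ Möbius covariance of the ℤ³ limit

It suffices to show X := W ∧ L ∧ N (card conformal-poisson-devices, S³ variant of its device). THE
DEVICE: the Poisson
process of intensity N(1+‖x‖²)⁻³dx on ℝ³ (the uniform process on S³ pushed down by stereographic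
projection; a.s. FINITE),
its Möbius–Delaunay graph (p ~ q iff some sphere-or-plane pencil form Q(z) = a‖z‖² + ⟨b,z⟩ + c
vanishes at p, q and is ≥ 0 on
the whole configuration = 1-skeleton of the convex hull of the stereographic lift, Brown 1979), ONE
constant n.n. ferromagnetic
Ising coupling β, free finite-volume Gibbs measure, spins read at the chordal-nearest device point
p_ω(x); F_N^β(x₁…xₙ) :=
E_ω⟨∏σ_{p_ω(xᵢ)}⟩ is the annealed correlator. W (DeviceWeylUniversality, rank 2): for every
pointwise scaling limit S of the
critical ℤ³ correlators there are β > 0, Δ > 0, c_N with c_N^n F_N^β → ∏ᵢ(1+‖xᵢ‖²)^Δ · S n locally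
uniformly on non-coincident
configurations. L (ExistsScaleCovariantLimit, shared item 1981): a normalised, non-degenerate,
translation-invariant,
scale-covariant pointwise limit S of criticalCorr 3 exists. N (IsingEuclidUpgradeR4NonGaussian,
shared item 0636): U₄ ≢ 0.
Everything else is provable glue: F_N^β is EXACTLY invariant under the unit inversion ι
(DeviceInversionSymmetry: the
intensity, the pencil rule and the chordal metric are O(4)-invariant, O(4) ∋ ι), so W transfers ι to
the limit as
IsInversionCovariant Δ S (InversionTransfer: (1+‖ιx‖²)/(1+‖x‖²) = ‖x‖⁻²), and ⟨translations, ι⟩ =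
Möb(3) upgrades
translation invariance + inversion covariance to IsMoebiusCovariant Δ S (MoebiusFromInversion) —
rotations and dilations are
OUTPUT, never assumed.
Lean: `DeviceWeylUniversality ∧ ExistsScaleCovariantLimit ∧ IsingEuclidUpgradeR4NonGaussian`

## Assembly
Pure logic plus one proved cone fact (checked sorry-free in the planner's SketchInline.lean, theorem
assembly_plumbing, with
PPP existence as hypothesis): take P_N from existsUnique_isPoissonPointProcess_holds (intensity
N(1+‖z‖²)⁻³dz is locally finite
and atomless), F := the inline annealed correlator (hF := rfl); obtain ρ, Δ₁, S from
ExistsScaleCovariantLimit; W gives β, Δ, c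
and the twisted convergence; DeviceInversionSymmetry + InversionTransfer (pointwise limits via
TendstoLocallyUniformlyOn.tendsto_at)
give IsInversionCovariant Δ S; MoebiusFromInversion with IsTranslationInvariant S gives
IsMoebiusCovariant Δ S;
IsingEuclidUpgradeR4NonGaussian gives HasNontrivialU4 S; conclude CritIsing3DConformalLimit with ⟨ρ,
Δ, S⟩ (Δ > 0 from W).

Rationale: WHY THIS LINE. Conformal symmetry is read off a sister model that HAS it exactly instead of being
upgraded from Euclidean data: a point
process can be invariant in law under a subgroup H ≤ Möb(3) only if H preserves a Radon measure, and
the maximal compact choice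
O(4) = Stab(point of H⁴) is realised by the uniform Poisson process on S³, whose Delaunay complex
(convex hull of the lift,
Brown1979) and constant-coupling Ising measure inherit O(4) ∋ ι exactly at every N and β
(ChristFriedbergLee1982 did this for
E(3) with flat Poisson lattices; BrowerFlemingNeuberger2013 and Cardy1985 keep dilatation +
inversion on a deterministic radial
lattice but need curvature counterterms; the fuzzy sphere ZhuEtAl2023 keeps SO(3) and tunes). The
only non-elementary input is
ONE universality statement of the most conservative kind (same ±1 spins, n.n. ferromagnet, local
graph law everywhere a
similarity copy of homogeneous Poisson–Delaunay, hence uniformly critical at the flat β_c^PD by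
symmetry, no position-dependent
couplings) — the device face of Benjamini–Schramm's density-invariance conjecture
(BenjaminiSchramm1998 §10.1, Thm 2.1 covers
d = 3 metrics), supported numerically by clean 3D-Ising exponents on Poissonian lattices
(JankeVillanova2002,
LimaCostaCostafilho2008; BarghathiVojta2014 criterion) and by Monte Carlo in conformally related 3D
geometries (DengBlote2002);
the sibling card weyl-universality-needs-interaction pins the channel a proof must use (Δ_ε ≈ 1.41 >
d−2,
KosPolandSimmonsDuffinVichi2016). Imported areas: stochastic geometry (Poisson processes, Mecke/Palm
calculus — in tree and
PROVED: IsPoissonPointProcess, existsUnique_isPoissonPointProcess_holds, multivariateMecke_holds;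
LastPenrose2017, Kingman1993),
convex geometry (Brown1979 lift), conformal group theory (⟨translations, ι⟩ = Möb(3),
DiFrancescoMathieuSenechal1997 §4.1), and
the physics of conformal regulators (Cardy1985, BrowerFlemingNeuberger2013, ZhuEtAl2023). Unlike
routes IsingEuclidUpgrade /
HyperoctahedralRP no Euclid+scale ⇒ Möbius step occurs (the refuted item 0637 and
Literature.Barriers…ScaleCovarianceNotMoebius
are not touched), rotations need no nine-mirror RP rigidity, and the negatives index (one SAW item)
is not approached.

RANKED CRUXES. #2 DeviceWeylUniversality (crux) — (card item W, S³ device) For every Poisson law P_N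
of intensity N(1+‖z‖²)⁻³dz on ℝ³ and the annealed Möbius–Delaunay Ising correlator F_N^β (free
finite-volume Gibbs measure on the pencil-rule graph of the a.s. finite configuration, spins at the
chordal-nearest points), and for every pointwise scaling limit S of criticalCorr 3 (ρ > 0 on (0,1],
non-degenerate): ∃ β > 0, Δ > 0, c : ℕ → ℝ with c_N^n F_N^β(n,·) → (∏ᵢ(1+‖xᵢ‖²)^Δ)·S n locally
uniformly on NonCoincident 3 n, for every n. Informally β = β_c^PD (flat Poisson–Delaunay critical
coupling) and c_N ≍ N^{Δ/3}; the statement quantifies F through its defining equation (hF) so that a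
later definition `annealedDeviceCorr` can replace the inline term verbatim. [difficulty:
open-problem] (why it might fail: ℤ³↔Poisson–Delaunay universality is itself open; Delaunay
connectivity disorder or the S³ curvature–ε coupling (irrelevant only because Δ_ε≈1.41>1, decaying
like N^-0.14) might leave a non-Weyl limit; a first-order or density-shifted PD transition voids
∃β.) [BenjaminiSchramm1998, BrowerFlemingNeuberger2013, Cardy1985, DengBlote2002,
JankeVillanova2002, LimaCostaCostafilho2008, BarghathiVojta2014, ZhuEtAl2023,
KosPolandSimmonsDuffinVichi2016, DuminilCopinICM2022]
#3 DeviceTwoPointConformal (crux) — (card: 'on the S³ device Δ is a one-variable fit'; ℤ³-free face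
of W at n = 2) With P_N, F_N^β as above: ∃ β > 0, Δ > 0, κ > 0, c with c_N² F_N^β(2,(x,y)) →
κ((1+‖x‖²)(1+‖y‖²))^Δ ‖x−y‖^{-2Δ} = κ(2/chord(x,y))^{2Δ} locally uniformly off the diagonal — the
annealed critical two-point function of the device is asymptotically a pure power of the S³ chordal
distance (by exact O(4) invariance it IS a function of the chord at every N). Implied by W ∧ L; its
refutation kills W; Monte-Carlo testable (kit) and the natural first proving ground (zonal harmonic
analysis on S³). [difficulty: XL] (why it might fail: Even at n=2 the annealed chordal two-point
function may fail to be a pure power: curvature corrections decay only like N^-0.14, Harris-type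
relevance of Delaunay disorder is excluded only numerically, and β_c^PD>0 finite on Delaunay graphs
is unproved.) [Cardy1985, ZhuEtAl2023, DengBlote2002, JankeVillanova2002, LimaCostaCostafilho2008]
#4 ExistsScaleCovariantLimit (crux) — (card item L; shared item stmt-1981 of route
HyperoctahedralRP, same signature) There are ρ > 0 on (0,1], Δ > 0 and S with
HasPointwiseScalingLimit (criticalCorr 3) ρ S, S = 0 off NonCoincident, IsNondegenerateTwoPoint S,
IsTranslationInvariant S, IsScaleCovariant Δ S. This route uses only existence, normalisation,
non-degeneracy and translation invariance (scale covariance and rotations are re-derived from the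
device); the Δ of W is identified with this Δ by non-degeneracy. [difficulty: open-problem] (why it
might fail: Full δ→0⁺ convergence with ONE continuous Δ is open on ℤ³: two-point bounds give only
subsequential limits with Δ∈[1/2,1], and GKS/RP axiomatics admit log-periodic (discretely
scale-covariant) profiles.) [DuminilCopinICM2022, DuminilcopinPanis2025, arXiv:1912.07973,
AizenmanDuminilCopinSidoravicius2015]
#5 IsingEuclidUpgradeR4NonGaussian (crux) — (card item N; shared item stmt-0636, same signature)
Every non-degenerate pointwise scaling limit S of the renormalised critical ℤ³ correlators has U₄ ≢
0 on non-coincident configurations (random-current intersection criterion). [difficulty: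
open-problem] (why it might fail: No proof that U₄≢0 in d=3: the double-current intersection
probability must stay positive at macroscopic separation as δ→0; RP long-range models on ℤ³ with
α<3/2 ARE Gaussian (LongRangeTrivialityOnZ3).) [AizenmanDuminilCopinAnnals2021, Panis2023Triviality,
DuminilCopinICM2022]
#9 DeviceInversionSymmetry (support) — (card item E, provable now) For every N, β, n and every
configuration x avoiding 0: F_N^β(n, ι∘x) = F_N^β(n, x), ι = unit inversion. Proof sketch: ι
preserves N(1+‖z‖²)⁻³dz (Jacobian ‖z‖⁻⁶ against (1+‖ιz‖²)⁻³ = ‖z‖⁶(1+‖z‖²)⁻³), so the image process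
is the same PPP (mapping theorem + IsPoissonPointProcess.unique, via a MeasurableEquiv of
PointConfig — no measurability of the integrand needed); the pencil rule is ι-equivariant since
Q(ιz) = (c‖z‖²+⟨b,z⟩+a)/‖z‖²; the chordal criterion ‖x−p‖²/(1+‖p‖²) is ι-equivariant up to the
x-only factor ‖x‖⁻²; a graph isomorphism carries the finite Gibbs average. (O(3) holds the same way
but is not load-bearing.) [difficulty: provable-now] [Kingman1993, LastPenrose2017, Brown1979]
#9 InversionTransfer (support) — (glue, provable now, device-agnostic) If S vanishes off
NonCoincident, a family G_N is exactly ι-invariant off 0 and c_N^n G_N(n,x) → (∏(1+‖xᵢ‖²)^Δ) S n x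
pointwise on NonCoincident, then IsInversionCovariant Δ S: uniqueness of limits and
(1+‖x‖²)/(1+‖ιx‖²) = ‖x‖² give S(ιx) = ∏‖xᵢ‖^{2Δ} S(x) for injective x; non-injective x map to
non-injective ιx (both 0). [difficulty: provable-now] [DiFrancescoMathieuSenechal1997]
#9 MoebiusFromInversion (support) — (glue, provable now; card
inversion-first-moebius-from-translations states the group fact) Translation invariance + inversion
covariance with Δ ⇒ IsMoebiusCovariant Δ S (rotations AND dilations are output). In every plane
through an axis ℝe the maps z ↦ z+s and ι∘τ_{se}∘ι : z ↦ z/(1+sz) generate PSL₂(ℝ) ∋ (z ↦ λz, z ↦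
−1/z = ι∘ρ_e), so dilations and all reflections ρ_e are finite words in translations and ι; apply
the two covariance laws along the word after conjugating by a generic translation so that no
intermediate point hits the pole (finitely many excluded v); the cocycle ∏|φ′(xᵢ)|^{-Δ} closes by
the chain rule. No normalisation or positivity of Δ needed. [difficulty: provable-now]
[DiFrancescoMathieuSenechal1997, Literature.Barriers.CriticalPhenomena.LiouvilleRigidity]

TWO-LAYER PLAN. Foreseen glued splits (nothing filed now): DeviceWeylUniversality ⇐
FlatPoissonDelaunayUniversality (homogeneous intensity-N
Poisson–Delaunay Ising at β_c^PD has the ℤ³ limit S up to constants; infinite-volume free state as ⨆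
over windows by GKS, in
tree) → LocalWeylWardIdentity (card item LW: Mecke's formula, PROVED in tree as
multivariateMecke_holds, turns d/dt of annealed
correlators along the density path ρ_t = (1+‖z‖²)^{-3t} into the insertion of the density score Θ_v;
crux: Θ_v acts on the
limit as the contact operator Σᵢ[(Δ/3)div v(xᵢ) + v(xᵢ)·∇ᵢ] with NO curvature channel, i.e. κ_R = 0
— the content of
conformality, using Δ_ε > 1) → DeviceWeylUniversality (integrate LW in t). DeviceTwoPointConformal ⇐
O(4) zonal expansion of
the annealed two-point function + a spectral-gap statement for the annealed radial transfer. Repair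
reserve if
MoebiusFromInversion were unexpectedly obstructed: the cylinder device (intensity N‖z‖⁻³dz on ℝ³∖0,
exact dilations + O(3) + ι
by accumulation at the poles; card's primary device) supplies dilations and rotations exactly as
extra support items.

KILL CRITERIA. DeviceTwoPointConformal refuted (a theorem, or a certified kit Monte Carlo showing an
angle-dependent effective exponent that does
not drift to a constant at the predicted N^-0.14 rate) ⇒ W is dead on the S³ device: close
`refuted:DeviceTwoPointConformal`
unless the cylinder device survives the same test (then pivot: restate W/E for intensity ‖z‖⁻³).
DeviceWeylUniversality refuted
with DeviceTwoPointConformal intact (n ≥ 3 cross-ratio functions differ from ℤ³'s) ⇒ PD and ℤ³ are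
different CFTs: close refuted,
hand the witness to the negative side (it would refute universality, a bigger result).
ExistsScaleCovariantLimit or
IsingEuclidUpgradeR4NonGaussian refuted ⇒ the conjunct itself fails for every route. A proof of
clause (ii) elsewhere (e.g.
HyperoctahedralRP's (B)+(D)) moots W but not DeviceTwoPointConformal, which stays a statement about
a second model.

NOT DECOMPOSED YET. The ℤ³ ↔ flat Poisson–Delaunay universality and the Ward-identity engine
(layer-2 children of W above); β_c^PD ∈ (0,∞) and
sharpness for Ising on Poisson–Delaunay graphs (unbounded degrees: comparison with FK percolation on
Delaunay graphs); a.s.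
general position / uniqueness of the chordal-nearest point and measurability of ω ↦ Gibbs average
for the count σ-algebra
(definition request D3 packages them); the identification c_N ≍ N^{Δ/3}; the O(3) and full O(4)
exactness (true, unused); the
reflection-positive 'conformal double' variant of the card feeding OS positivity (other route:
modular/RP cards).

CHEAPEST FALSIFIER. Literature first: JankeVillanova2002 / LimaCostaCostafilho2008 report clean
3D-Ising exponents on 3D Poissonian random lattices —
a first-order or new-universality finding there would have killed W at once (it did not). Then ONE
kit job on
DeviceTwoPointConformal (no ℤ³, no Δ input): n ~ 10⁴–10⁵ uniform points on S³, graph = convex hull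
in ℝ⁴ (qhull), Wolff-cluster
Ising at the flat β_c^PD (Binder crossing on periodic flat Poisson–Delaunay samples), annealed ⟨σσ⟩
against the chord: the
log-log slope must be chord-independent, ≈ 2Δ_σ ≈ 1.036, drifting at most like N^-0.14; a
non-shrinking percent-level angular
modulation refutes the crux. Conjunct-level companion on ℤ³ itself (card): the balanced sphere-swap
ratio
⟨σ_{mx₁}σ_{mx₂}σ_{z₃}σ_{z₄}⟩/⟨σ_{x₁}σ_{x₂}σ_{mz₃}σ_{mz₄}⟩ → 1 at β_c (|xᵢ|≈|zⱼ|≈L→∞), predicted by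
inversion covariance and not
by Euclid+scale. Neither run here (planner unit, no kit); recommended as the refuter's first move.
Formal sanity run here: all
eight decls and the assembly plumbing elaborate sorry-free (lean check rc 0).

NUMBERS. Δ_σ = 0.5181489(10), Δ_ε = 1.412625(10), ν = 0.629971(4) (KosPolandSimmonsDuffinVichi2016);
relevance window of the sibling
card d−2 = 1 < Δ_ε < 2 = d−1 (satisfied; GFF has Δ_{φ²} = 1, marginal — its witness does not
transfer); predicted finite-N
anomaly exponent (Δ_ε−1)/3 ≈ 0.1375; c_N ≍ N^{Δ_σ/3} ≈ N^{0.173}; mean number of device points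
N·π²/4 ≈ 2.47 N; rigorous window
for any ℤ³ scaling dimension Δ ∈ [1/2, 1] (tree: scalingDimension_mem_Icc_holds); S³ scalar
curvature in device units ∝ N^{-2/3}.
Items at open: 8 (4 cruxes, 3 support, 1 assembly).

DEFINITION REQUESTS. D1 `moebiusDelaunayGraph (ω : Set (EuclideanSpace ℝ (Fin 3))) : SimpleGraph _`
— the pencil rule used inline (Adj p q := p ≠ q ∧
p,q ∈ ω ∧ ∃ (a,b,c) ≠ 0, Q(p) = Q(q) = 0 ∧ ∀ z ∈ ω, 0 ≤ Q z), with lemmas: equals the 1-skeleton of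
the convex hull of the
stereographic lift for finite ω in general position (Brown1979); equivariance under similarities and
under the unit inversion
for 0 ∉ ω. D2 `chordalNearest ω x` (argmin of ‖x−p‖²/(1+‖p‖²)) with a.s. uniqueness under a PPP with
a density. D3
`annealedDeviceCorr (P : Measure (PointConfig (EuclideanSpace ℝ (Fin 3)))) (β : ℝ) : CorrFamily 3` —
the inline integrand of
W/E packaged, with the measurability lemma for the count σ-algebra (so the Bochner integral is not
junk) and |·| ≤ 1; topic
Summits/CriticalPhenomena/Ising3DConformalLimit/Theorems (objects posited for this problem).
Cite-fact wanted (not load-bearing):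
non-triviality and sharpness of the Ising transition on the homogeneous Poisson–Delaunay graph of
ℝ³.

Novelty: Searches (2026-08-15): `lit search --source crossref` "Ising model Voronoi Delaunay lattice three
dimensions" (8: Lima et al.
2000 Physica A, Sousa–Lima 2013), "critical behavior Ising model three-dimensional Poissonian random
lattice" (5:
LimaCostaCostafilho2008), "lattice radial quantization Ising" (6: BrowerFlemingNeuberger2013,
Neuberger2014 cubature,
Brower–Cheng–Fleming PoS 2014), "conformal invariance Ising model three dimensions curved geometry
Monte Carlo" (6: DengBlote2002,
Delamotte–Tissier–Wschebor 2016), "fuzzy sphere Ising conformal field theory three dimensions" (6: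
ZhuEtAl2023 line, Wiese 2026,
Läuchli et al. 2025); `lit galaxy search --star all` "Ising model on a random lattice sphere
conformal" (0), "lattice radial
quantization" (0), "Poissonian random lattice" (1: ar5iv 1001.2918 Blume–Capel on Voronoi–Delaunay);
`lit frontier
CriticalPhenomena --since 2020` (30 rows, none on random/curved regulators), `lit bridges
CriticalPhenomena --cross any` (30, none);
`lit read` BenjaminiSchramm1998 Thm 2.1 (PDF p.4) and §10.1 (PDF pp.27–28, "probably true only in
dimension d = 2");
OpenAlex/arXiv/S2 returned HTTP 429 all session (logged); the card's own audited searches (BFN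
pp.4–5 read by the refuter) are
inherited. `lean search` found the Poisson/Mecke library (IsPoissonPointProcess,
multivariateMecke_holds) that makes the device
typable today.
Nearest prior art found: BrowerFlemingNeuberger2013 (doi:10.1016/j.physletb.2013.03.009:
deterministic radial lattice with  [refs: 10.1016/j.physletb.2013.03.009:, doi:10.1016/j.physletb.2013.03.009, LimaCostaCostafilho2008, BrowerFlemingNeuberger2013, Neuberger2014, DengBlote2002, ZhuEtAl2023, BenjaminiSchramm1998, ChristFriedbergLee1982, Cardy1985]

Barriers (technique_class: symmetry-manifesting-discretisation, weyl-universality): - technique_class: symmetry-manifesting-discretisation, weyl-universality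
- Literature.Barriers.CriticalPhenomena.ScaleCovarianceNotMoebius: evaded — nothing is upgraded from
Euclid+scale data; inversion covariance is imported from the exact ι-symmetry of a second Gibbs
model through the Ising-specific hypothesis W (scope caveat (a): the barrier's witness is a bare
CorrFamily, not a limit of any ι-symmetric ferromagnet); scale covariance and rotations are OUTPUT
of MoebiusFromInversion, and the refuted tree item 0637 (IsingEuclidUpgradeR5InversionUpgrade) is
not re-asked in any form.
- Literature.Barriers.CriticalPhenomena.LiouvilleRigidity: applies (d = 3, no local conformal maps
beyond Möbius) and is the resource: finite generation ⟨translations, ι⟩ = Möb(3) is exactly why ONE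
exact device symmetry suffices (MoebiusFromInversion); the no-go 'no locally finite point process is
Möb(3)-invariant' is why at least one universality statement is unavoidable.
- Literature.Barriers.CriticalPhenomena.BootstrapLatticeBlindness: not met — no CFT axiom, OPE or
bootstrap datum enters; every item names lattice / point-process objects (criticalCorr 3,
IsPoissonPointProcess, isingExpect).
- Literature.Barriers.CriticalPhenomena.IsingTrivialityFromDimensionFour: consonant — W is stated in
d = 3 only and its intended proof spends Δ_ε > d−2 (card weyl-universality-needs-interaction shows W
fails for the Gaussian fixed point and for Ising in d ≥ 4); clause (iii) is imported as the shared
item 0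

History (route lifecycle, newest last):
- 2026-08-26T09:38:06Z · DORMANT — reconciler: no traction for 8.4 d (last activity item-evidence-added at 2026-08-17T23:11:32Z); parked, not closed — `ledger route dormant route-CriticalPhenomen (operator:999:915483)
- 2026-08-27T15:15:21Z · REACTIVATED — reconciler: reactivated — activity statement-checked at 2026-08-27T13:51:04Z after parking at 2026-08-26T09:38:06Z (operator:999:4172677)

sub-problem: Ising3DConformalLimit · status: open · opened planner-plancard-CriticalPhenomena-Ising3DCon-5455952c-0 2026-08-15T11:34:53Z · rev 4 · ledger route-CriticalPhenomena-ConformalPoissonDevice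
GENERATED by the gate from the ledger (D-0016/17). Provers cite these decls: `theorem foo : Summit.CriticalPhenomena.Ising3DConformalLimit.Theses.ConformalPoissonDevice.<Decl> := …` in Summits/CriticalPhenomena/Ising3DConformalLimit/Theorems/<Name>.lean.
-/

namespace Summit.CriticalPhenomena.Ising3DConformalLimit.Theses.ConformalPoissonDevice

open scoped BigOperators Topology Manifold Classical MeasureTheory ProbabilityTheory Matrix InnerProductSpace ComplexConjugate ContinuousMap
open Filter Set Function TopologicalSpace MeasureTheory

attribute [summit_statement] _root_.Ising3DConformalLimit

/-- item stmt-CriticalPhenomena-4722 · crux · rank 2 · open · by planner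
why it might fail: ℤ³↔Poisson–Delaunay universality is unproved even heuristically: Harris α=2−3ν=+0.110>0; PD disorder escapes only via the Barghathi–Vojta aν>1 rule (a=(d+1)/2), a heuristic with a known violation (SchrauthPortelaGoth2018), + numerics ≤50³; curvature–ε drift only N^-0.1375; first-order PD voids ∃β.
sources: JankeVillanova2002, BarghathiVojta2014, SchrauthPortelaGoth2018, SchrauthPortela2019, BenjaminiSchramm1998, DuminilCopinICM2022
[crux] (card item W, S³ device) For every Poisson law P_N of intensity N(1+‖z‖²)⁻³dz on ℝ³ and the
annealed Möbius–Delaunay Ising correlator F_N^β (free finite-volume Gibbs measure on the pencil-rule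
graph of the a.s. finite configuration, spins at the chordal-nearest points), and for every
pointwise scaling limit S of criticalCorr 3 (ρ > 0 on (0,1], non-degenerate): ∃ β > 0, Δ > 0, c : ℕ
→ ℝ with c_N^n F_N^β(n,·) → (∏ᵢ(1+‖xᵢ‖²)^Δ)·S n locally uniformly on NonCoincident 3 n, for every n.
Informally β = β_c^PD (flat Poisson–Delaunay critical coupling) and c_N ≍ N^{Δ/3}; the statement
quantifies F through its defining equation (hF) so that a later definition `annealedDeviceCorr` can
replace the inline term verbatim. [difficulty: open-problem] -/
@[route_item "route-CriticalPhenomena-ConformalPoissonDevice", crux]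
def DeviceWeylUniversality : Prop :=
  ∀ (P : ℕ → Measure (Literature.Analysis.FunctionSpaces.PointConfig (EuclideanSpace ℝ (Fin 3)))) (F : ℕ → ℝ → (n : ℕ) → (Fin n → EuclideanSpace ℝ (Fin 3)) → ℝ), (∀ N : ℕ, Literature.Analysis.FunctionSpaces.IsPoissonPointProcess ((N : ENNReal) • (volume : Measure (EuclideanSpace ℝ (Fin 3))).withDensity (fun z => ENNReal.ofReal ((1 + ‖z‖ ^ 2) ^ (-(3:ℝ))))) (P N)) → (∀ (N : ℕ) (β : ℝ) (n : ℕ) (x : Fin n → EuclideanSpace ℝ (Fin 3)), F N β n x = ∫ ω, (if h : (ω : Set (EuclideanSpace ℝ (Fin 3))).Finite then Literature.Probability.LatticeModels.isingExpect (SimpleGraph.fromRel fun p q : ↥h.toFinset => ∃ (a c : ℝ) (b : EuclideanSpace ℝ (Fin 3)), (a ≠ 0 ∨ b ≠ 0 ∨ c ≠ 0) ∧ a * ‖(p : EuclideanSpace ℝ (Fin 3))‖ ^ 2 + inner ℝ b (p : EuclideanSpace ℝ (Fin 3)) + c = 0 ∧ a * ‖(q : EuclideanSpace ℝ (Fin 3))‖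 ^ 2 + inner ℝ b (q : EuclideanSpace ℝ (Fin 3)) + c = 0 ∧ ∀ z ∈ ω, 0 ≤ a * ‖z‖ ^ 2 + inner ℝ b z + c) Finset.univ β 0 Literature.Probability.LatticeModels.BoundaryCondition.free (fun σ => ∏ i, ∏ v ∈ Finset.univ.filter (fun v : ↥h.toFinset => (v : EuclideanSpace ℝ (Fin 3)) = Classical.epsilon (fun p : EuclideanSpace ℝ (Fin 3) => p ∈ ω ∧ ∀ q ∈ ω, ‖x i - p‖ ^ 2 / (1 + ‖p‖ ^ 2) ≤ ‖x i - q‖ ^ 2 / (1 + ‖q‖ ^ 2))), Literature.Probability.LatticeModels.spinAt v σ) else 0) ∂(P N)) → ∀ (ρ : ℝ → ℝ) (S : Literature.Probability.LatticeModels.CorrFamily 3), (∀ δ ∈ Set.Ioc (0:ℝ) 1, 0 < ρ δ) → Literature.Probability.LatticeModels.HasPointwiseScalingLimit (Literature.Probability.LatticeModels.criticalCorr 3) ρ S → Literature.Probability.LatticeModels.IsNondegenerateTwoPoint S → ∃ (β Δ : ℝ) (c : ℕ → ℝ), 0 < β ∧ 0 < Δ ∧ ∀ n, TendstoLocallyUniformlyOn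 (fun N x => c N ^ n * F N β n x) (fun x => (∏ i, (1 + ‖x i‖ ^ 2) ^ Δ) * S n x) Filter.atTop (Literature.Probability.LatticeModels.NonCoincident 3 n)

/-- item stmt-CriticalPhenomena-4723 · crux · rank 3 · open · by planner
why it might fail: A pure chord power at O(1) chord IS Weyl covariance of the device's own limit: fails if the PD fixed point is scale- but not conformally invariant, if PD connectivity disorder is relevant (α=+0.110; aν>1 is a heuristic with a known violation, SchrauthPortelaGoth2018), or if PD is first-order.
sources: Cardy1985, JankeVillanova2002, BarghathiVojta2014, SchrauthPortelaGoth2018, AizenmanDuminilCopinSidoravicius2015, ZhuEtAl2023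
[crux] (card: 'on the S³ device Δ is a one-variable fit'; ℤ³-free face of W at n = 2) With P_N,
F_N^β as above: ∃ β > 0, Δ > 0, κ > 0, c with c_N² F_N^β(2,(x,y)) → κ((1+‖x‖²)(1+‖y‖²))^Δ
‖x−y‖^{-2Δ} = κ(2/chord(x,y))^{2Δ} locally uniformly off the diagonal — the annealed critical
two-point function of the device is asymptotically a pure power of the S³ chordal distance (by exact
O(4) invariance it IS a function of the chord at every N). Implied by W ∧ L; its refutation kills W;
Monte-Carlo testable (kit) and the natural first proving ground (zonal harmonic analysis on S³).
[difficulty: XL] -/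
@[route_item "route-CriticalPhenomena-ConformalPoissonDevice", crux]
def DeviceTwoPointConformal : Prop :=
  ∀ (P : ℕ → Measure (Literature.Analysis.FunctionSpaces.PointConfig (EuclideanSpace ℝ (Fin 3)))) (F : ℕ → ℝ → (n : ℕ) → (Fin n → EuclideanSpace ℝ (Fin 3)) → ℝ), (∀ N : ℕ, Literature.Analysis.FunctionSpaces.IsPoissonPointProcess ((N : ENNReal) • (volume : Measure (EuclideanSpace ℝ (Fin 3))).withDensity (fun z => ENNReal.ofReal ((1 + ‖z‖ ^ 2) ^ (-(3:ℝ))))) (P N)) → (∀ (N : ℕ) (β : ℝ) (n : ℕ) (x : Fin n → EuclideanSpace ℝ (Fin 3)), F N β n x = ∫ ω, (if h : (ω : Set (EuclideanSpace ℝ (Fin 3))).Finite then Literature.Probability.LatticeModels.isingExpect (SimpleGraph.fromRel fun p q : ↥h.toFinset => ∃ (a c : ℝ) (b : EuclideanSpace ℝ (Fin 3)), (a ≠ 0 ∨ b ≠ 0 ∨ c ≠ 0) ∧ a * ‖(p : EuclideanSpace ℝ (Fin 3))‖ ^ 2 + inner ℝ b (p : EuclideanSpace ℝ (Fin 3)) +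 c = 0 ∧ a * ‖(q : EuclideanSpace ℝ (Fin 3))‖ ^ 2 + inner ℝ b (q : EuclideanSpace ℝ (Fin 3)) + c = 0 ∧ ∀ z ∈ ω, 0 ≤ a * ‖z‖ ^ 2 + inner ℝ b z + c) Finset.univ β 0 Literature.Probability.LatticeModels.BoundaryCondition.free (fun σ => ∏ i, ∏ v ∈ Finset.univ.filter (fun v : ↥h.toFinset => (v : EuclideanSpace ℝ (Fin 3)) = Classical.epsilon (fun p : EuclideanSpace ℝ (Fin 3) => p ∈ ω ∧ ∀ q ∈ ω, ‖x i - p‖ ^ 2 / (1 + ‖p‖ ^ 2) ≤ ‖x i - q‖ ^ 2 / (1 + ‖q‖ ^ 2))), Literature.Probability.LatticeModels.spinAt v σ) else 0) ∂(P N)) → ∃ (β Δ κ : ℝ) (c : ℕ → ℝ), 0 < β ∧ 0 < Δ ∧ 0 < κ ∧ TendstoLocallyUniformlyOn (fun N (y : Fin 2 → EuclideanSpace ℝ (Fin 3)) => c N ^ 2 * F N β 2 y) (fun y => κ * (((1 + ‖y 0‖ ^ 2) * (1 + ‖y 1‖ ^ 2)) ^ Δ / ‖y 0 - y 1‖ ^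 (2 * Δ))) Filter.atTop (Literature.Probability.LatticeModels.NonCoincident 3 2)

/-- item stmt-CriticalPhenomena-1981 · crux · rank 4 · SPLIT (gen 1) into TwoPointDoubling, ClusterSetTotallyDisconnected + glue ExistsScaleCovariantLimitGlue · direct attempts still welcome (low priority) · by planner
why it might fail: Full δ→0⁺ convergence with ONE continuous Δ is open on ℤ³: two-point bounds give only subsequential limits with Δ∈[1/2,1], and GKS/RP axiomatics admit log-periodic (discretely scale-covariant) profiles.
sources: DuminilCopinICM2022, DuminilcopinPanis2025, arXiv:1912.07973, AizenmanDuminilCopinSidoravicius2015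
[crux r4, (C), existence WITHOUT rotations] There are ρ > 0 on (0,1], Δ > 0 and S with
HasPointwiseScalingLimit (criticalCorr 3) ρ S, S = 0 off NonCoincident, IsNondegenerateTwoPoint S,
IsTranslationInvariant S, IsScaleCovariant Δ S. Strictly weaker than CritIsing3DEuclideanLimit (item
0638: rotations included) — on this route isotropy is OUTPUT. Inputs in tree:
criticalTwoPoint_bounds_holds (c|x|⁻² ≤ G ≤ C|x|⁻¹ ⇒ subsequential limits, Δ ∈ [1/2,1]); missing:
uniqueness/full-filter convergence and continuous scale covariance (DuminilCopinICM2022 §8.4 p.29: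
'widely open'). -/
@[route_item "route-CriticalPhenomena-ConformalPoissonDevice", crux]
def ExistsScaleCovariantLimit : Prop :=
  ∃ (ρ : ℝ → ℝ) (Δ : ℝ) (S : Literature.Probability.LatticeModels.CorrFamily 3), (∀ δ ∈ Set.Ioc (0:ℝ) 1, 0 < ρ δ) ∧ 0 < Δ ∧ Literature.Probability.LatticeModels.HasPointwiseScalingLimit (Literature.Probability.LatticeModels.criticalCorr 3) ρ S ∧ (∀ n z, z ∉ Literature.Probability.LatticeModels.NonCoincident 3 n → S n z = 0) ∧ Literature.Probability.LatticeModels.IsNondegenerateTwoPoint S ∧ Literature.Probability.LatticeModels.IsTranslationInvariant S ∧ Literature.Probability.LatticeModels.IsScaleCovariant Δ S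

-- parent: ExistsScaleCovariantLimit · child (gen 1)
/--     item stmt-CriticalPhenomena-6150 · crux · rank 401 · open
    parent: ExistsScaleCovariantLimit · by planner
    why it might fail: = ADC21 Rem 5.10/§5.6 (open): RP+MMS+IR+sliding-scale IR+DCP24 Thm 1.2/1.3 admit completely monotone episodic profiles with g(2m)/g(m)→0 (Disproof §E; crux NOTES c9/c14); an Ising-specific two-scale lower bound is missing in d=3 (current mixing quantitative only in d≥4, arXiv:2406.15243).
    sources: AizenmanDuminilCopinAnnals2021, arXiv:1912.07973, arXiv:2404.05700, arXiv:2509.02850, arXiv:2406.15243, DuminilCopinICM2022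
[crux] (D) ALL-SCALE DOUBLING of the axial critical two-point function on ℤ³: there is κ > 0 with
g(2n) ≥ κ·g(n) for all n ≥ 1, g(n) := ⟨σ₀σ_{n e₁}⟩⁺_{β_c(3)} (card item M3; = D1 of card
every-scale-regular-multiplicative-fekete). With MMS it gives G(z′) ≍ G(z) for ‖z′‖ ≍ ‖z‖ in all
directions; it is the one open LATTICE input of the compactness half and is filed first (the import
cone of everything below is otherwise proved: criticalTwoPoint_bounds_holds,
messager_miracleSole_holds, RP lemmas). [difficulty: open-problem] -/
@[route_item "route-CriticalPhenomena-ConformalPoissonDevice"]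
def TwoPointDoubling : Prop :=
  ∃ κ : ℝ, 0 < κ ∧ ∀ n : ℕ, 1 ≤ n → κ * Literature.Probability.LatticeModels.criticalTwoPoint 3 (Pi.single 0 (n : ℤ)) ≤ Literature.Probability.LatticeModels.criticalTwoPoint 3 (Pi.single 0 (2 * (n : ℤ)))

-- parent: ExistsScaleCovariantLimit · child (gen 1)
/--     item stmt-CriticalPhenomena-4659 · crux · rank 402 · open
    parent: ExistsScaleCovariantLimit · by planner
    why it might fail: Identification half of the open existence problem (ICM22 §8.4): no lattice mechanism pins the higher correlators of a cluster point in d=3 (no discrete holomorphicity; Ising₃ CFT isolation conjectural, Rychkov 2020); an arc of cluster points with drifting Δ_σ/OPE data passes all tree inequalities.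
    sources: DuminilCopinICM2022, PolandRychkovVichi2019, Rychkov2020, AizenmanDuminilCopinAnnals2021
[crux] the cluster set 𝒞 of the self-normalised family is totally disconnected in the pointwise
(product) topology of CorrFamily 3 (on 𝒞, compact under Reg, this coincides with the locally uniform
topology; pointwise is the stronger ask otherwise). INTENDED ENGINE (card items (2)–(4), the route's
point, layer 2): 𝒞 ⊆ 𝓘 := σ-correlator families of LOCAL unitary ℤ₂-symmetric 3D CFTs with exactly
one relevant odd and exactly one relevant non-identity even scalar and Δ_σ ≤ 1 (lattice side: OS
positivity, clustering, covariance and spectrum of cluster points), and 𝓘 is totally disconnected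
(CFT side, lattice-blind: 'It is expected that most local CFTs are isolated. One exception are CFTs
with exactly marginal fields of dimension Δ = d … A folk conjecture says that exactly marginal
fields in d ≥ 3 require supersymmetry' — Rychkov2020, arXiv:2007.14315 p.8, read this session; LOCAL
= 'critical points of lattice models with finite-range interactions', ibid., which is what excludes
the non-local long-range arc; an ANALYTIC isolation theorem for exact solutions of crossing — NOT a
finite-Λ positivity certificate, which only gives diam ≤ ε(Λ): refuter flag on the card, accepted).
Both halves -/
@[route_item "route-CriticalPhenomena-ConformalPoissonDevice"]
def ClusterSetTotallyDisconnected : Prop :=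
  IsTotallyDisconnected {S : Literature.Probability.LatticeModels.CorrFamily 3 | (∀ n x, x ∉ Literature.Probability.LatticeModels.NonCoincident 3 n → S n x = 0) ∧ ∃ u : ℕ → ℝ, (∀ k, u k ∈ Set.Ioc (0:ℝ) 1) ∧ Filter.Tendsto u Filter.atTop (nhds 0) ∧ ∀ n, TendstoLocallyUniformlyOn (fun k => Literature.Probability.LatticeModels.rescaledCorrelator (Literature.Probability.LatticeModels.criticalCorr 3) (fun δ : ℝ => (Literature.Probability.LatticeModels.criticalTwoPoint 3 (Pi.single 0 ⌊δ⁻¹⌋)) ^ (-(1/2:ℝ))) n (u k)) (S n) Filter.atTop (Literature.Probability.LatticeModels.NonCoincident 3 n)}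

-- parent: ExistsScaleCovariantLimit · glue (gen 1)
/--     item stmt-CriticalPhenomena-18016 · support · rank 403 · open
    parent: ExistsScaleCovariantLimit · GLUE: children ⟹ parent · by operator
TwoPointDoubling → ClusterSetTotallyDisconnected → ExistsScaleCovariantLimit — PROVED and LANDED for
the identical decl body:
Summit.CriticalPhenomena.Ising3DConformalLimit.Cruxes.ExistsScaleCovariantLimit.PositivityBegetsConformalityMaps.crux_of_doubling_of_totallyDisconnected
(p144658; exactness crux ⟺ 6150 ∧ 4659:
FoldedCurrentRepulsion.crux_iff_doubling_and_totallyDisconnected, p139907); a prover closes this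
glue item with that one decl (δ-unfolding; probe bc/cpd_glue_defeq.lean rc 0). Children are items
6150 / 4659 VERBATIM. -/
@[route_item "route-CriticalPhenomena-ConformalPoissonDevice"]
def ExistsScaleCovariantLimitGlue : Prop :=
  TwoPointDoubling → ClusterSetTotallyDisconnected → ExistsScaleCovariantLimit

/-- item stmt-CriticalPhenomena-0636 · crux · rank 5 · open · by planner
why it might fail: No proof that U₄≢0 in d=3: the double-current intersection probability must stay positive at macroscopic separation as δ→0; RP long-range models on ℤ³ with α<3/2 ARE Gaussian (LongRangeTrivialityOnZ3).
sources: AizenmanDuminilCopinAnnals2021, Panis2023Triviality, DuminilCopinICM2022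
Crux r4 (non-triviality in d=3): every non-degenerate pointwise scaling limit S of the renormalised
critical Ising correlators on Z^3 has connected four-point function U4 ≢ 0 on non-coincident
configurations. Intended tool: the random-current identity U4(x,y,z,t) =
−2⟨σxσy⟩⟨σzσt⟩·P^{xy,zt}[C_{n1+n2}(x) ∩ C_{n1+n2}(z) ≠ ∅] (Aizenman 1982; ADC2021 arXiv:1912.07973
eq. (3.11)): non-Gaussianity ⇔ the intersection probability of the two double-current clusters at
macroscopic separation does not vanish as δ → 0. Contrast: for d ≥ 4 every such limit IS Gaussian
(Literature.Probability.LatticeModels.highDim_triviality). Its negation refutes the conjunct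
Ising3DConformalLimit itself. -/
@[route_item "route-CriticalPhenomena-ConformalPoissonDevice", crux]
def IsingEuclidUpgradeR4NonGaussian : Prop :=
  ∀ (ρ : ℝ → ℝ) (S : Literature.Probability.LatticeModels.CorrFamily 3), (∀ δ ∈ Set.Ioc (0:ℝ) 1, 0 < ρ δ) → Literature.Probability.LatticeModels.HasPointwiseScalingLimit (Literature.Probability.LatticeModels.criticalCorr 3) ρ S → Literature.Probability.LatticeModels.IsNondegenerateTwoPoint S → Literature.Probability.LatticeModels.HasNontrivialU4 S

/-- item stmt-CriticalPhenomena-4724 · support · rank 9 · open · by planner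
sources: Kingman1993, LastPenrose2017, Brown1979
[support] (card item E, provable now) For every N, β, n and every configuration x avoiding 0:
F_N^β(n, ι∘x) = F_N^β(n, x), ι = unit inversion. Proof sketch: ι preserves N(1+‖z‖²)⁻³dz (Jacobian
‖z‖⁻⁶ against (1+‖ιz‖²)⁻³ = ‖z‖⁶(1+‖z‖²)⁻³), so the image process is the same PPP (mapping theorem +
IsPoissonPointProcess.unique, via a MeasurableEquiv of PointConfig — no measurability of the
integrand needed); the pencil rule is ι-equivariant since Q(ιz) = (c‖z‖²+⟨b,z⟩+a)/‖z‖²; the chordal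
criterion ‖x−p‖²/(1+‖p‖²) is ι-equivariant up to the x-only factor ‖x‖⁻²; a graph isomorphism
carries the finite Gibbs average. (O(3) holds the same way but is not load-bearing.) [difficulty:
provable-now] -/
@[route_item "route-CriticalPhenomena-ConformalPoissonDevice", crux]
def DeviceInversionSymmetry : Prop :=
  ∀ (P : ℕ → Measure (Literature.Analysis.FunctionSpaces.PointConfig (EuclideanSpace ℝ (Fin 3)))) (F : ℕ → ℝ → (n : ℕ) → (Fin n → EuclideanSpace ℝ (Fin 3)) → ℝ), (∀ N : ℕ, Literature.Analysis.FunctionSpaces.IsPoissonPointProcess ((N : ENNReal) • (volume : Measure (EuclideanSpace ℝ (Fin 3))).withDensity (fun z => ENNReal.ofReal ((1 + ‖z‖ ^ 2) ^ (-(3:ℝ))))) (P N)) → (∀ (N : ℕ) (β : ℝ) (n : ℕ) (x : Fin n → EuclideanSpace ℝ (Fin 3)), F N β n x = ∫ ω, (if h : (ω : Set (EuclideanSpace ℝ (Fin 3))).Finite then Literature.Probability.LatticeModels.isingExpect (SimpleGraph.fromRel fun p q : ↥h.toFinset => ∃ (a c : ℝ) (b : EuclideanSpace ℝ (Fin 3)),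 (a ≠ 0 ∨ b ≠ 0 ∨ c ≠ 0) ∧ a * ‖(p : EuclideanSpace ℝ (Fin 3))‖ ^ 2 + inner ℝ b (p : EuclideanSpace ℝ (Fin 3)) + c = 0 ∧ a * ‖(q : EuclideanSpace ℝ (Fin 3))‖ ^ 2 + inner ℝ b (q : EuclideanSpace ℝ (Fin 3)) + c = 0 ∧ ∀ z ∈ ω, 0 ≤ a * ‖z‖ ^ 2 + inner ℝ b z + c) Finset.univ β 0 Literature.Probability.LatticeModels.BoundaryCondition.free (fun σ => ∏ i, ∏ v ∈ Finset.univ.filter (fun v : ↥h.toFinset => (v : EuclideanSpace ℝ (Fin 3)) = Classical.epsilon (fun p : EuclideanSpace ℝ (Fin 3) => p ∈ ω ∧ ∀ q ∈ ω, ‖x i - p‖ ^ 2 / (1 + ‖p‖ ^ 2) ≤ ‖x i - q‖ ^ 2 / (1 + ‖q‖ ^ 2))), Literature.Probability.LatticeModels.spinAt v σ) else 0) ∂(P N)) → ∀ (N : ℕ) (β : ℝ) (n : ℕ) (x : Fin n → EuclideanSpace ℝ (Fin 3)), (∀ i, x i ≠ 0) → F N β n (fun i => EuclideanGeometry.inversion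 0 1 (x i)) = F N β n x

/-- item stmt-CriticalPhenomena-4725 · support · rank 9 · open · by planner
sources: DiFrancescoMathieuSenechal1997
[support] (glue, provable now, device-agnostic) If S vanishes off NonCoincident, a family G_N is
exactly ι-invariant off 0 and c_N^n G_N(n,x) → (∏(1+‖xᵢ‖²)^Δ) S n x pointwise on NonCoincident, then
IsInversionCovariant Δ S: uniqueness of limits and (1+‖x‖²)/(1+‖ιx‖²) = ‖x‖² give S(ιx) = ∏‖xᵢ‖^{2Δ}
S(x) for injective x; non-injective x map to non-injective ιx (both 0). [difficulty: provable-now] -/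
@[route_item "route-CriticalPhenomena-ConformalPoissonDevice", crux]
def InversionTransfer : Prop :=
  ∀ (Δ : ℝ) (S : Literature.Probability.LatticeModels.CorrFamily 3) (G : ℕ → Literature.Probability.LatticeModels.CorrFamily 3) (c : ℕ → ℝ), (∀ n z, z ∉ Literature.Probability.LatticeModels.NonCoincident 3 n → S n z = 0) → (∀ N n (x : Fin n → EuclideanSpace ℝ (Fin 3)), (∀ i, x i ≠ 0) → G N n (fun i => EuclideanGeometry.inversion 0 1 (x i)) = G N n x) → (∀ n, ∀ x ∈ Literature.Probability.LatticeModels.NonCoincident 3 n, Filter.Tendsto (fun N => c N ^ n * G N n x) Filter.atTop (nhds ((∏ i, (1 + ‖x i‖ ^ 2) ^ Δ) * S n x))) → Literature.Probability.LatticeModels.IsInversionCovariant Δ S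

/-- item stmt-CriticalPhenomena-4726 · support · rank 9 · open · by planner
sources: DiFrancescoMathieuSenechal1997, Literature.Barriers.CriticalPhenomena.LiouvilleRigidity
[support] (glue, provable now; card inversion-first-moebius-from-translations states the group fact)
Translation invariance + inversion covariance with Δ ⇒ IsMoebiusCovariant Δ S (rotations AND
dilations are output). In every plane through an axis ℝe the maps z ↦ z+s and ι∘τ_{se}∘ι : z ↦
z/(1+sz) generate PSL₂(ℝ) ∋ (z ↦ λz, z ↦ −1/z = ι∘ρ_e), so dilations and all reflections ρ_e are
finite words in translations and ι; apply the two covariance laws along the word after conjugating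
by a generic translation so that no intermediate point hits the pole (finitely many excluded v); the
cocycle ∏|φ′(xᵢ)|^{-Δ} closes by the chain rule. No normalisation or positivity of Δ needed.
[difficulty: provable-now] -/
@[route_item "route-CriticalPhenomena-ConformalPoissonDevice", crux]
def MoebiusFromInversion : Prop :=
  ∀ (Δ : ℝ) (S : Literature.Probability.LatticeModels.CorrFamily 3), Literature.Probability.LatticeModels.IsTranslationInvariant S → Literature.Probability.LatticeModels.IsInversionCovariant Δ S → Literature.Probability.LatticeModels.IsMoebiusCovariant Δ S

/-- item stmt-CriticalPhenomena-4727 · assembly · rank 1 · open · by planner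
sources: DuminilCopinICM2022, PolandRychkovVichi2019
[assembly] DeviceWeylUniversality → DeviceInversionSymmetry → InversionTransfer →
MoebiusFromInversion → ExistsScaleCovariantLimit → IsingEuclidUpgradeR4NonGaussian →
Ising3DConformalLimit. -/
@[route_item "route-CriticalPhenomena-ConformalPoissonDevice", crux]
def Assembly : Prop :=
  DeviceWeylUniversality → DeviceInversionSymmetry → InversionTransfer → MoebiusFromInversion → ExistsScaleCovariantLimit → IsingEuclidUpgradeR4NonGaussian → Ising3DConformalLimit

/-! D-0027 §2.1 — DECIDING THEOREM (planner-authored via `route open/edit --closes-file`; by operator:999:2941348 2026-08-15T15:21:04Z):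
its hypotheses are this route's items and its conclusion the sub-problem Statement (glue_lint), and it elaborates with this file. -/

@[closes "route-CriticalPhenomena-ConformalPoissonDevice"] theorem closes : DeviceWeylUniversality → DeviceTwoPointConformal → ExistsScaleCovariantLimit → IsingEuclidUpgradeR4NonGaussian → DeviceInversionSymmetry → InversionTransfer → MoebiusFromInversion → Assembly → _root_.Ising3DConformalLimit := fun h_DeviceWeylUniversality h_DeviceTwoPointConformal h_ExistsScaleCovariantLimit h_IsingEuclidUpgradeR4NonGaussian h_DeviceInversionSymmetry h_InversionTransfer h_MoebiusFromInversion h_Assembly => h_Assembly h_DeviceWeylUniversality h_DeviceInversionSymmetry h_InversionTransfer h_MoebiusFromInversion h_ExistsScaleCovariantLimit h_IsingEuclidUpgradeR4NonGaussian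

end Summit.CriticalPhenomena.Ising3DConformalLimit.Theses.ConformalPoissonDevice
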